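import Literature.MeasureTheory.Group.CoveringWeightsBochner
import Mathlib.GroupTheory.GroupAction.ConjAct
import Mathlib.MeasureTheory.Group.Integral
import Mathlib.MeasureTheory.Integral.Prod
import HarnessLib

/-!
# Averaging a covering weight over a fundamental domain of a normalised subgroup

Topic `MeasureTheory/Group`; namespace `Literature.MeasureTheory.Group`. A companion to
`CoveringWeights` / `CoveringWeightsBochner` (Weil's unfolding in the language of covering weights;
Weil, *L'intégration dans les groupes topologiques* (1940), §9; Bourbaki, *Intégration* VII §2;
Cogdell (2004), §2.3 [cite: CogdellAnalyticTheory2004, §2.3]): the step "integrate first over `N(K)\N(𝔸)`" of the classical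
unfolding of an automorphic integral along a parabolic subgroup, phrased on the group.

**Setting.** `Γ ≤ G` countable acting on `X`, `U ≤ G` a subgroup normalised by `Γ` (think
`Γ = P(K)`, `U = N(𝔸)` the unipotent radical), `U_Γ = U ∩ Γ` (as `Γ.subgroupOf U ≤ U` and
`U.subgroupOf Γ ⊴ Γ`), `μU` a measure on `U` invariant under left translation by `U_Γ`, and a
measurable fundamental domain `𝓕 ⊆ U` for `U_Γ` (`∀ u, ∃! η ∈ U_Γ, η u ∈ 𝓕`).

* `tsum_eq_tsum_quotient_tsum` — `Σ_{γ ∈ Γ} f(γ) = Σ_{q ∈ Γ/N} Σ_{η ∈ N} f(q.out η)` via the explicit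
  bijection `outMulEquiv : (Γ ⧸ N) × N ≃ Γ`.
* `lintegral_eq_tsum_setLIntegral_of_fundamentalDomain`,
  `tsum_setLIntegral_mul_eq_lintegral_of_fundamentalDomain` — `∫_U h = Σ_η ∫_𝓕 h(η⁻¹ v) dv` and
  (for commutative `U`) `Σ_η ∫_𝓕 g(u η) du = ∫_U g`.
* `tsum_setLIntegral_smul_smul_eq` — **the key computation**: if moreover `U` is commutative and
  `Γ`, `U` commute in the mean (`∫_U f(γ u • x) dμU = ∫_U f(u γ • x) dμU`, e.g. `μU` the Haar measure of
  `N(𝔸)`, invariant under conjugation by `P(K)` by the product formula), then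
  `Σ_{γ ∈ Γ} ∫_𝓕 β(u γ • x) dμU(u) = ∫_𝓕 Σ_{γ ∈ Γ} β(γ u • x) dμU(u)`.
* `avgWeight U μU 𝓕 β x = μU(𝓕)⁻¹ ∫_𝓕 β(u • x) dμU(u)` — the **averaged weight**; it is measurable
  (`measurable_avgWeight`) and, by the key computation, **again a `Γ`-covering weight with covering
  sums `1`** when `β` is (`coveringSum_avgWeight_eq_one`, Part A).
* `integral_wt_avgWeight_smul_eq` — **the averaging identity** (Part B): for a `G`-invariant `ν` on
  `X`, `∫_X β♭ Ψ dν = ∫_X β(y) (μU(𝓕)⁻¹ ∫_𝓕 Ψ(u⁻¹ • y) dμU(u)) dν(y)` for strongly measurable `Ψ`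
  with `∫ ‖Ψ‖ β♭ dν < ∞` (Fubini twice, invariance of `ν`).

Combined with `integral_wt_smul_eq_of_coveringSum_eq_one` (`CoveringWeightsBochner`: the integral
of a `Γ`-invariant `Ψ` against a weight depends only on the covering sums) this gives, for
`Γ`-invariant `Ψ`, `∫ β Ψ dν = ∫ β (Ψ averaged over 𝓕 ≅ U_Γ\U) dν` — in particular `∫ β Ψ dν = 0`
when the `U`-average ("constant term") of `Ψ` vanishes. Used for the vanishing of the singular theta
terms against cusp forms in the Godement–Jacquet functional equation (`GL_n`, `n ≥ 2`).

## References

* A. Weil, *L'intégration dans les groupes topologiques et ses applications* (1940), §9; N. Bourbaki,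
  *Intégration*, Ch. VII, §2 [folklore].
* J. W. Cogdell, *Lectures on L-functions, converse theorems, and functoriality for GL_n* (2004), §2.3
  [CogdellAnalyticTheory2004].
* R. Godement, H. Jacquet, *Zeta functions of simple algebras*, LNM 260 (1972), §12
  [GodementJacquet1972].
-/

noncomputable section

open _root_.MeasureTheory _root_.MeasureTheory.Measure Set Filter Function
open scoped ENNReal NNReal Pointwise

namespace Literature.MeasureTheory.Group

/-! ### Coset bookkeeping: `Γ ≃ (Γ ⧸ N) × N` explicitly -/

section Cosets

variable {Γ : Type*} [Group Γ] (N : Subgroup Γ)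

/-- The explicit bijection `(Γ ⧸ N) × N → Γ`, `(q, η) ↦ q.out * η`. [folklore] -/
def outMulEquiv : (Γ ⧸ N) × N ≃ Γ :=
  Equiv.ofBijective (fun p : (Γ ⧸ N) × N => p.1.out * (p.2 : Γ))
    (by
      constructor
      · rintro ⟨q₁, η₁⟩ ⟨q₂, η₂⟩ h
        have h' : q₁.out * (η₁ : Γ) = q₂.out * (η₂ : Γ) := h
        have hq : q₁ = q₂ := by
          have e₁ : (QuotientGroup.mk (q₁.out * (η₁ : Γ)) : Γ ⧸ N) = q₁ := by
            rw [QuotientGroup.mk_mul_of_mem _ η₁.2, QuotientGroup.out_eq']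
          have e₂ : (QuotientGroup.mk (q₂.out * (η₂ : Γ)) : Γ ⧸ N) = q₂ := by
            rw [QuotientGroup.mk_mul_of_mem _ η₂.2, QuotientGroup.out_eq']
          rw [← e₁, ← e₂, h']
        subst hq
        have hη : (η₁ : Γ) = η₂ := mul_left_cancel h'
        exact Prod.ext rfl (Subtype.ext hη)
      · intro γ
        obtain ⟨h, hh⟩ := QuotientGroup.mk_out_eq_mul N γ
        refine ⟨((QuotientGroup.mk γ : Γ ⧸ N), h⁻¹), ?_⟩
        change (QuotientGroup.mk γ : Γ ⧸ N).out * ((h⁻¹ : N) : Γ) = γ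
        rw [hh, Subgroup.coe_inv, mul_assoc, mul_inv_cancel, mul_one])

/-- Unfolding of `outMulEquiv`. [folklore] -/
theorem outMulEquiv_apply (p : (Γ ⧸ N) × N) : outMulEquiv N p = p.1.out * (p.2 : Γ) := rfl

/-- **Sums over `Γ` as double sums over `Γ ⧸ N` and `N`**: `Σ_γ f(γ) = Σ_q Σ_{η ∈ N} f(q.out η)`
(`ℝ≥0∞`-valued). [folklore] -/
theorem tsum_eq_tsum_quotient_tsum (f : Γ → ℝ≥0∞) :
    ∑' γ : Γ, f γ = ∑' q : Γ ⧸ N, ∑' η : N, f (q.out * (η : Γ)) := by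
  rw [← (outMulEquiv N).tsum_eq f]
  exact ENNReal.tsum_prod (f := fun (q : Γ ⧸ N) (η : N) => f (q.out * (η : Γ)))

end Cosets

/-! ### Decomposing integrals over `U` along a lattice `U_Γ = U ∩ Γ` with a fundamental domain -/

section Lattice

variable {G : Type*} [Group G] [MeasurableSpace G] [MeasurableMul₂ G]
  (Γ : Subgroup G) (U : Subgroup G) (μU : Measure U)

variable {Γ U}

/-- Left multiplication on the subgroup `U` is measurable. [folklore] -/
theorem measurable_mul_left_subgroup (η : U) : Measurable fun u : U => η * u :=
  (measurable_const.mul measurable_subtype_coe).subtype_mk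

/-- Right multiplication on the subgroup `U` is measurable. [folklore] -/
theorem measurable_mul_right_subgroup (η : U) : Measurable fun u : U => u * η :=
  (measurable_subtype_coe.mul measurable_const).subtype_mk

variable (Γ U)

omit [MeasurableSpace G] [MeasurableMul₂ G] in
/-- **Covering sums of a fundamental domain**: if every `u ∈ U` has exactly one `η ∈ U_Γ` with
`η u ∈ 𝓕`, then `Σ_{η ∈ U_Γ} 𝟙_𝓕(η u) = 1`. [folklore] -/
theorem tsum_indicator_mul_eq_one {𝓕 : Set U} (h𝓕 : ∀ u : U, ∃! η : Γ.subgroupOf U, ((η : U) * u) ∈ 𝓕)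
    (u : U) : ∑' η : Γ.subgroupOf U, 𝓕.indicator (1 : U → ℝ≥0∞) ((η : U) * u) = 1 := by
  obtain ⟨η₀, hη₀, huniq⟩ := h𝓕 u
  rw [tsum_eq_single η₀]
  · rw [Set.indicator_of_mem hη₀, Pi.one_apply]
  · intro η hη
    rw [Set.indicator_of_notMem]
    exact fun hmem => hη (huniq η hmem)

variable {μU}

/-- **Left decomposition of `∫_U` along the lattice**: `∫_U h dμU = Σ_{η ∈ U_Γ} ∫_𝓕 h(η⁻¹ v) dμU(v)`
for `μU` invariant under left translations by `U_Γ` and a fundamental domain `𝓕`. [folklore] -/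
theorem lintegral_eq_tsum_setLIntegral_of_fundamentalDomain [Countable (Γ.subgroupOf U)]
    (hleft : ∀ η : Γ.subgroupOf U, ∀ f : U → ℝ≥0∞, Measurable f →
      ∫⁻ u, f ((η : U) * u) ∂μU = ∫⁻ u, f u ∂μU)
    {𝓕 : Set U} (h𝓕m : MeasurableSet 𝓕) (h𝓕 : ∀ u : U, ∃! η : Γ.subgroupOf U, ((η : U) * u) ∈ 𝓕)
    {h : U → ℝ≥0∞} (hh : Measurable h) :
    ∫⁻ u, h u ∂μU = ∑' η : Γ.subgroupOf U, ∫⁻ v in 𝓕, h ((η : U)⁻¹ * v) ∂μU := by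
  have hm : ∀ η : Γ.subgroupOf U, Measurable fun u : U => 𝓕.indicator (1 : U → ℝ≥0∞) ((η : U) * u) * h u :=
    fun η => ((measurable_one.indicator h𝓕m).comp (measurable_mul_left_subgroup (η : U))).mul hh
  calc ∫⁻ u, h u ∂μU = ∫⁻ u, (∑' η : Γ.subgroupOf U, 𝓕.indicator (1 : U → ℝ≥0∞) ((η : U) * u)) * h u ∂μU := by
        refine lintegral_congr fun u => ?_
        rw [tsum_indicator_mul_eq_one Γ U h𝓕 u, one_mul]
    _ = ∫⁻ u, ∑' η : Γ.subgroupOf U, 𝓕.indicator (1 : U → ℝ≥0∞) ((η : U) * u) * h u ∂μU := by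
        refine lintegral_congr fun u => ?_
        rw [ENNReal.tsum_mul_right]
    _ = ∑' η : Γ.subgroupOf U, ∫⁻ u, 𝓕.indicator (1 : U → ℝ≥0∞) ((η : U) * u) * h u ∂μU :=
        lintegral_tsum fun η => (hm η).aemeasurable
    _ = ∑' η : Γ.subgroupOf U, ∫⁻ v in 𝓕, h ((η : U)⁻¹ * v) ∂μU := by
        refine tsum_congr fun η => ?_
        -- substitute `v = η u`: `f(v) = 𝟙_𝓕(v) h(η⁻¹ v)` has `f(η u) = 𝟙_𝓕(η u) h(u)`
        have hf : Measurable fun v : U => 𝓕.indicator (1 : U → ℝ≥0∞) v * h ((η : U)⁻¹ * v) :=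
          (measurable_one.indicator h𝓕m).mul (hh.comp (measurable_mul_left_subgroup ((η : U)⁻¹)))
        have e := hleft η _ hf
        simp only [inv_mul_cancel_left] at e
        rw [e, ← lintegral_indicator h𝓕m]
        refine lintegral_congr fun v => ?_
        by_cases hv : v ∈ 𝓕
        · rw [Set.indicator_of_mem hv, Set.indicator_of_mem hv, Pi.one_apply, one_mul]
        · rw [Set.indicator_of_notMem hv, Set.indicator_of_notMem hv, zero_mul]

/-- **Right decomposition** (commutative `U`): `Σ_{η ∈ U_Γ} ∫_𝓕 g(u η) dμU(u) = ∫_U g dμU`. [folklore] -/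
theorem tsum_setLIntegral_mul_eq_lintegral_of_fundamentalDomain [Countable (Γ.subgroupOf U)]
    (hU : ∀ a b : U, a * b = b * a)
    (hleft : ∀ η : Γ.subgroupOf U, ∀ f : U → ℝ≥0∞, Measurable f →
      ∫⁻ u, f ((η : U) * u) ∂μU = ∫⁻ u, f u ∂μU)
    {𝓕 : Set U} (h𝓕m : MeasurableSet 𝓕) (h𝓕 : ∀ u : U, ∃! η : Γ.subgroupOf U, ((η : U) * u) ∈ 𝓕)
    {g : U → ℝ≥0∞} (hg : Measurable g) :
    ∑' η : Γ.subgroupOf U, ∫⁻ u in 𝓕, g (u * (η : U)) ∂μU = ∫⁻ u, g u ∂μU := by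
  rw [lintegral_eq_tsum_setLIntegral_of_fundamentalDomain Γ U hleft h𝓕m h𝓕 hg,
    ← (Equiv.inv (Γ.subgroupOf U)).tsum_eq (fun η : Γ.subgroupOf U => ∫⁻ v in 𝓕, g ((η : U)⁻¹ * v) ∂μU)]
  refine tsum_congr fun η => ?_
  refine setLIntegral_congr_fun h𝓕m fun u _ => ?_
  simp only [Equiv.inv_apply, Subgroup.coe_inv, inv_inv, hU u]

end Lattice

/-! ### The averaged weight is a weight -/

section Averaged

variable {G : Type*} [Group G] [MeasurableSpace G] [MeasurableMul₂ G]
  {X : Type*} [MulAction G X] [MeasurableSpace X] [MeasurableSMul₂ G X]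
  (Γ : Subgroup G) [Countable Γ] (U : Subgroup G) (μU : Measure U)

/-- **The averaged weight** `β♭(x) = μU(𝓕)⁻¹ ∫_𝓕 β(u • x) dμU(u)` of `β : X → [0, ∞]` over a piece
`𝓕 ⊆ U`. [folklore] -/
def avgWeight (𝓕 : Set U) (β : X → ℝ≥0∞) (x : X) : ℝ≥0∞ :=
  (μU 𝓕)⁻¹ * ∫⁻ u in 𝓕, β ((u : G) • x) ∂μU

variable {Γ U}

omit [MeasurableSpace G] [MeasurableMul₂ G] [Countable Γ] in
/-- `U ∩ Γ ≤ Γ` (Mathlib `U.subgroupOf Γ`) is normal when `Γ` normalises `U`. [folklore] -/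
theorem normal_subgroupOf_of_forall_conj_mem (hnorm : ∀ γ ∈ Γ, ∀ u ∈ U, γ * u * γ⁻¹ ∈ U) : (U.subgroupOf Γ).Normal :=
  ⟨fun η hη γ => by
    change ((γ : G) * (η : G) * (γ : G)⁻¹) ∈ U
    exact hnorm γ γ.2 η hη⟩

/-- The two incarnations of the lattice are the same group. [folklore] -/
def latticeEquiv : U.subgroupOf Γ ≃ Γ.subgroupOf U where
  toFun η := ⟨⟨((η : Γ) : G), η.2⟩, by change ((η : Γ) : G) ∈ Γ; exact (η : Γ).2⟩
  invFun η := ⟨⟨((η : U) : G), η.2⟩, by change ((η : U) : G) ∈ U; exact (η : U).2⟩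
  left_inv η := rfl
  right_inv η := rfl

omit [MeasurableSpace G] [MeasurableMul₂ G] [Countable Γ] in
/-- Coercions through `latticeEquiv` (definitional). [folklore] -/
theorem coe_coe_latticeEquiv (η : U.subgroupOf Γ) : (((latticeEquiv η : Γ.subgroupOf U) : U) : G) = ((η : Γ) : G) := rfl

omit [MeasurableMul₂ G] in
/-- Measurability of `u ↦ β(u • y)` on `U`. [folklore] -/
theorem measurable_comp_coe_smul {β : X → ℝ≥0∞} (hβ : Measurable β) (y : X) :
    Measurable fun u : U => β ((u : G) • y) :=
  hβ.comp (measurable_subtype_coe.smul_const y)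

variable (Γ U)

/-- **The key computation**: for `Γ` normalising the commutative `U`, `μU` invariant under `U_Γ`,
`Γ` and `U` commuting in the mean, and a fundamental domain `𝓕` of `U_Γ` in `U`:
`Σ_{γ ∈ Γ} ∫_𝓕 β(u γ • x) dμU(u) = ∫_𝓕 (Σ_{γ ∈ Γ} β(γ u • x)) dμU(u)`. Proof: write `Γ = ⊔ q U_Γ`;
for each coset the sum over `U_Γ` and the integral over `𝓕` recombine into an integral over `U`
(right decomposition, normality to commute `η` past the representative), the representative moves past
`u` in the mean, and the integral over `U` decomposes again along `U_Γ` and `𝓕` (left decomposition);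
the double sum is the sum over `Γ`. [folklore] -/
theorem tsum_setLIntegral_smul_smul_eq [Countable (Γ.subgroupOf U)]
    (hnorm : ∀ γ ∈ Γ, ∀ u ∈ U, γ * u * γ⁻¹ ∈ U) (hU : ∀ a b : U, a * b = b * a)
    (hleft : ∀ η : Γ.subgroupOf U, ∀ f : U → ℝ≥0∞, Measurable f →
      ∫⁻ u, f ((η : U) * u) ∂μU = ∫⁻ u, f u ∂μU)
    (hcomm : ∀ (γ : Γ) (x : X) (f : X → ℝ≥0∞), Measurable f →
      ∫⁻ u : U, f ((γ : G) • (u : G) • x) ∂μU = ∫⁻ u : U, f ((u : G) • (γ : G) • x) ∂μU)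
    {𝓕 : Set U} (h𝓕m : MeasurableSet 𝓕) (h𝓕 : ∀ u : U, ∃! η : Γ.subgroupOf U, ((η : U) * u) ∈ 𝓕)
    {β : X → ℝ≥0∞} (hβ : Measurable β) (x : X) :
    ∑' γ : Γ, ∫⁻ u in 𝓕, β ((u : G) • (γ : G) • x) ∂μU = ∫⁻ u in 𝓕, coveringSum Γ β ((u : G) • x) ∂μU := by
  haveI : (U.subgroupOf Γ).Normal := normal_subgroupOf_of_forall_conj_mem hnorm
  haveI : Countable (U.subgroupOf Γ) := Countable.of_equiv _ latticeEquiv.symm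
  set N : Subgroup Γ := U.subgroupOf Γ with hN
  -- Step 1: the sum over `Γ` as a sum over cosets and over the lattice
  rw [tsum_eq_tsum_quotient_tsum N (fun γ : Γ => ∫⁻ u in 𝓕, β ((u : G) • (γ : G) • x) ∂μU)]
  -- Steps 2–4, coset by coset
  have hq : ∀ q : Γ ⧸ N, ∑' η : N, ∫⁻ u in 𝓕, β ((u : G) • ((q.out * (η : Γ) : Γ) : G) • x) ∂μU =
      ∑' η : Γ.subgroupOf U, ∫⁻ v in 𝓕,
        β ((((q.out : Γ) : G) * (((η : U) : G))⁻¹) • (v : G) • x) ∂μU := by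
    intro q
    -- Step 2a: reindex the lattice by conjugation, `q.out * (q.out⁻¹ η q.out) = η * q.out`
    have e2a : ∑' η : N, ∫⁻ u in 𝓕, β ((u : G) • ((q.out * (η : Γ) : Γ) : G) • x) ∂μU =
        ∑' η : N, ∫⁻ u in 𝓕, β ((u : G) • (((η : Γ) * q.out : Γ) : G) • x) ∂μU := by
      rw [← ((MulAut.conjNormal (H := N) q.out).symm.toEquiv).tsum_eq
        (fun η : N => ∫⁻ u in 𝓕, β ((u : G) • ((q.out * (η : Γ) : Γ) : G) • x) ∂μU)]
      refine tsum_congr fun η => ?_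
      have hc : q.out * (((MulAut.conjNormal (H := N) q.out).symm.toEquiv η : N) : Γ) = (η : Γ) * q.out := by
        rw [MulEquiv.toEquiv_eq_coe, MulEquiv.coe_toEquiv, MulAut.conjNormal_symm_apply]
        group
      rw [hc]
    rw [e2a]
    -- Step 2b: `u • (η q.out) • x = (u η) • q.out • x`, and the lattice sum with `∫_𝓕` is `∫_U`
    have e2b : ∑' η : N, ∫⁻ u in 𝓕, β ((u : G) • (((η : Γ) * q.out : Γ) : G) • x) ∂μU =
        ∑' η : Γ.subgroupOf U, ∫⁻ u in 𝓕, β (((u * (η : U) : U) : G) • ((q.out : Γ) : G) • x) ∂μU := by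
      rw [← latticeEquiv.symm.tsum_eq (fun η : N => ∫⁻ u in 𝓕, β ((u : G) • (((η : Γ) * q.out : Γ) : G) • x) ∂μU)]
      refine tsum_congr fun η => ?_
      refine setLIntegral_congr_fun h𝓕m fun u _ => ?_
      rw [Subgroup.coe_mul, Subgroup.coe_mul, mul_smul, smul_smul]
      rfl
    rw [e2b, tsum_setLIntegral_mul_eq_lintegral_of_fundamentalDomain Γ U hU hleft h𝓕m h𝓕
      (measurable_comp_coe_smul hβ _)]
    -- Step 3: move `q.out` past `u` in the mean
    rw [← hcomm q.out x β hβ]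
    -- Step 4: left decomposition of `∫_U` along the lattice
    rw [lintegral_eq_tsum_setLIntegral_of_fundamentalDomain Γ U hleft h𝓕m h𝓕
      (h := fun u : U => β (((q.out : Γ) : G) • (u : G) • x))
      (hβ.comp ((measurable_subtype_coe.smul_const x).const_smul _))]
    refine tsum_congr fun η => setLIntegral_congr_fun h𝓕m fun v _ => ?_
    simp only [Subgroup.coe_mul, Subgroup.coe_inv, mul_smul]
  simp_rw [hq]
  -- Step 5: interchange sums and integral, and recognise the covering sum
  have hmeas : ∀ (q : Γ ⧸ N) (η : Γ.subgroupOf U), Measurable fun v : U =>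
      β ((((q.out : Γ) : G) * (((η : U) : G))⁻¹) • (v : G) • x) := fun q η =>
    hβ.comp ((measurable_subtype_coe.smul_const x).const_smul _)
  have e5a : ∀ q : Γ ⧸ N, ∑' η : Γ.subgroupOf U, ∫⁻ v in 𝓕,
      β ((((q.out : Γ) : G) * (((η : U) : G))⁻¹) • (v : G) • x) ∂μU =
      ∫⁻ v in 𝓕, ∑' η : Γ.subgroupOf U, β ((((q.out : Γ) : G) * (((η : U) : G))⁻¹) • (v : G) • x) ∂μU :=
    fun q => (lintegral_tsum fun η => (hmeas q η).aemeasurable).symm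
  simp_rw [e5a]
  haveI : Countable (Γ ⧸ N) := (QuotientGroup.mk_surjective (s := N)).countable
  rw [← lintegral_tsum fun q => (Measurable.tsum fun η => hmeas q η).aemeasurable]
  refine setLIntegral_congr_fun h𝓕m fun v _ => ?_
  -- pointwise: the double sum is the covering sum at `v • x`
  rw [coveringSum_apply, tsum_eq_tsum_quotient_tsum N (fun γ : Γ => β (γ • (v : G) • x))]
  refine tsum_congr fun q => ?_
  rw [← (Equiv.inv N).tsum_eq (fun η : N => β ((q.out * (η : Γ) : Γ) • (v : G) • x)),
    ← latticeEquiv.symm.tsum_eq (fun η : N => β ((q.out * ((Equiv.inv N η : N) : Γ) : Γ) • (v : G) • x))]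
  refine tsum_congr fun η => ?_
  simp only [Equiv.inv_apply, Subgroup.smul_def, Subgroup.coe_mul, Subgroup.coe_inv]
  rfl

omit [MeasurableMul₂ G] [MeasurableSpace X] [MeasurableSMul₂ G X] in
/-- Unfolding of `avgWeight`. [folklore] -/
theorem avgWeight_apply (𝓕 : Set U) (β : X → ℝ≥0∞) (x : X) :
    avgWeight U μU 𝓕 β x = (μU 𝓕)⁻¹ * ∫⁻ u in 𝓕, β ((u : G) • x) ∂μU := rfl

omit [MeasurableMul₂ G] [Countable Γ] in
/-- The averaged weight is measurable (`μU` s-finite). [folklore] -/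
theorem measurable_avgWeight [SFinite μU] {𝓕 : Set U} {β : X → ℝ≥0∞} (hβ : Measurable β) :
    Measurable (avgWeight U μU 𝓕 β) := by
  unfold avgWeight
  refine Measurable.const_mul ?_ _
  have hj : Measurable fun p : X × U => β ((p.2 : G) • p.1) :=
    hβ.comp ((measurable_subtype_coe.comp measurable_snd).smul measurable_fst)
  exact hj.lintegral_prod_right' (ν := μU.restrict 𝓕)

/-- **The averaged weight of a `Γ`-covering weight is a `Γ`-covering weight** (Part A): under the
hypotheses of `tsum_setLIntegral_smul_smul_eq` and `0 < μU(𝓕) < ∞`, if `Σ_γ β(γ • y) = 1` for all `y`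
then `Σ_γ β♭(γ • x) = 1` for all `x`. [folklore] -/
theorem coveringSum_avgWeight_eq_one [Countable (Γ.subgroupOf U)]
    (hnorm : ∀ γ ∈ Γ, ∀ u ∈ U, γ * u * γ⁻¹ ∈ U) (hU : ∀ a b : U, a * b = b * a)
    (hleft : ∀ η : Γ.subgroupOf U, ∀ f : U → ℝ≥0∞, Measurable f →
      ∫⁻ u, f ((η : U) * u) ∂μU = ∫⁻ u, f u ∂μU)
    (hcomm : ∀ (γ : Γ) (x : X) (f : X → ℝ≥0∞), Measurable f →
      ∫⁻ u : U, f ((γ : G) • (u : G) • x) ∂μU = ∫⁻ u : U, f ((u : G) • (γ : G) • x) ∂μU)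
    {𝓕 : Set U} (h𝓕m : MeasurableSet 𝓕) (h𝓕 : ∀ u : U, ∃! η : Γ.subgroupOf U, ((η : U) * u) ∈ 𝓕)
    (h𝓕₀ : μU 𝓕 ≠ 0) (h𝓕top : μU 𝓕 ≠ ∞)
    {β : X → ℝ≥0∞} (hβ : Measurable β) (hβ₁ : ∀ y, coveringSum Γ β y = 1) (x : X) :
    coveringSum Γ (avgWeight U μU 𝓕 β) x = 1 := by
  rw [coveringSum_apply]
  simp_rw [avgWeight_apply]
  rw [ENNReal.tsum_mul_left]
  have e : ∑' γ : Γ, ∫⁻ u in 𝓕, β ((u : G) • γ • x) ∂μU = ∫⁻ u in 𝓕, coveringSum Γ β ((u : G) • x) ∂μU :=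
    tsum_setLIntegral_smul_smul_eq Γ U μU hnorm hU hleft hcomm h𝓕m h𝓕 hβ x
  rw [e]
  simp_rw [hβ₁]
  rw [setLIntegral_one, ENNReal.inv_mul_cancel h𝓕₀ h𝓕top]

end Averaged

/-! ### The averaging identity (Part B) -/

section AveragingIdentity

variable {G : Type*} [Group G] [MeasurableSpace G] [MeasurableInv G]
  {X : Type*} [MulAction G X] [MeasurableSpace X] [MeasurableSMul₂ G X]
  (U : Subgroup G) (μU : Measure U) [SFinite μU] (ν : Measure X) [SFinite ν]
  [SMulInvariantMeasure G X ν]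
  {E : Type*} [NormedAddCommGroup E] [NormedSpace ℝ E] [CompleteSpace E]

omit [MeasurableInv G] [SFinite μU] [MeasurableSpace X] in
/-- `wt β` of a finite weight has `‖wt β y‖ₑ = β y`. [folklore] -/
theorem enorm_wt_eq {β : X → ℝ≥0∞} {y : X} (h : β y ≠ ∞) : ‖wt β y‖ₑ = β y := by
  rw [Real.enorm_of_nonneg ENNReal.toReal_nonneg]
  exact ENNReal.ofReal_toReal h

/-- **The averaging identity**: for a `G`-invariant s-finite `ν` on `X`, a measurable weight
`β ≤ 1`, a piece `𝓕 ⊆ U` of finite measure and a strongly measurable `Ψ : X → E` with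
`∫ ‖Ψ‖ β♭ dν < ∞`,
`∫_X β♭(x) Ψ(x) dν(x) = ∫_X β(y) · (μU(𝓕)⁻¹ ∫_𝓕 Ψ(u⁻¹ • y) dμU(u)) dν(y)`:
the averaged weight against `Ψ` is the weight against the `𝓕`-average of `Ψ` (Fubini twice and the
invariance of `ν`). [folklore] -/
theorem integral_wt_avgWeight_smul_eq {𝓕 : Set U} (h𝓕₀ : μU 𝓕 ≠ 0) (h𝓕top : μU 𝓕 ≠ ∞)
    {β : X → ℝ≥0∞} (hβ : Measurable β) (hβle : ∀ y, β y ≤ 1)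
    {Ψ : X → E} (hΨm : StronglyMeasurable Ψ)
    (hint : ∫⁻ y, ‖Ψ y‖ₑ * avgWeight U μU 𝓕 β y ∂ν < ∞) :
    ∫ x, wt (avgWeight U μU 𝓕 β) x • Ψ x ∂ν =
      ∫ y, wt β y • ((μU 𝓕).toReal⁻¹ • ∫ u in 𝓕, Ψ ((u : G)⁻¹ • y) ∂μU) ∂ν := by
  have hβlt : ∀ y, β y < ∞ := fun y => (hβle y).trans_lt ENNReal.one_lt_top
  set c : ℝ≥0∞ := μU 𝓕 with hc
  -- measurability facts
  have hm₁ : Measurable fun p : X × U => β ((p.2 : G) • p.1) :=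
    hβ.comp ((measurable_subtype_coe.comp measurable_snd).smul measurable_fst)
  have hm₂ : Measurable fun p : U × X => β ((p.1 : G) • p.2) :=
    hβ.comp ((measurable_subtype_coe.comp measurable_fst).smul measurable_snd)
  have hmu : ∀ x : X, Measurable fun u : U => β ((u : G) • x) := fun x =>
    hβ.comp (measurable_subtype_coe.smul_const x)
  have hΨe : Measurable fun x => ‖Ψ x‖ₑ := hΨm.enorm
  -- the key finite quantity `I = ∫_X (∫_𝓕 β(u x) du) ‖Ψ x‖ dν = c ∫ ‖Ψ‖ β♭ < ∞`
  have hI : ∫⁻ x, (∫⁻ u in 𝓕, β ((u : G) • x) ∂μU) * ‖Ψ x‖ₑ ∂ν < ∞ := by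
    have e : ∀ x, (∫⁻ u in 𝓕, β ((u : G) • x) ∂μU) * ‖Ψ x‖ₑ =
        c * (‖Ψ x‖ₑ * avgWeight U μU 𝓕 β x) := by
      intro x
      rw [avgWeight_apply]
      set L := ∫⁻ u in 𝓕, β ((u : G) • x) ∂μU
      rw [show c * (‖Ψ x‖ₑ * (c⁻¹ * L)) = c * c⁻¹ * (L * ‖Ψ x‖ₑ) by ring,
        ENNReal.mul_inv_cancel h𝓕₀ h𝓕top, one_mul]
    simp_rw [e]
    rw [lintegral_const_mul' _ _ h𝓕top]
    exact ENNReal.mul_lt_top h𝓕top.lt_top hint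
  -- (1) the averaged weight, pointwise, as a Bochner integral
  have h1 : ∀ x, wt (avgWeight U μU 𝓕 β) x = c.toReal⁻¹ * ∫ u in 𝓕, wt β ((u : G) • x) ∂μU := by
    intro x
    change (avgWeight U μU 𝓕 β x).toReal = c.toReal⁻¹ * ∫ u in 𝓕, (β ((u : G) • x)).toReal ∂μU
    rw [avgWeight_apply, ENNReal.toReal_mul, ENNReal.toReal_inv,
      integral_toReal (hmu x).aemeasurable (ae_of_all _ fun u => hβlt _)]
  -- (4) invariance of `ν`, fibrewise
  have h4 : ∀ u : U, ∫ x, wt β ((u : G) • x) • Ψ x ∂ν = ∫ y, wt β y • Ψ ((u : G)⁻¹ • y) ∂ν := by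
    intro u
    have := integral_smul_eq_self (μ := ν) (fun y => wt β y • Ψ ((u : G)⁻¹ • y)) (g := (u : G))
    simp only [inv_smul_smul] at this
    exact this
  -- (3) integrability on `X × 𝓕`
  have hint₁ : Integrable (uncurry fun (x : X) (u : U) => wt β ((u : G) • x) • Ψ x)
      (ν.prod (μU.restrict 𝓕)) := by
    refine ⟨(hm₁.ennreal_toReal.aestronglyMeasurable).smul
      ((hΨm.comp_measurable measurable_fst).aestronglyMeasurable), ?_⟩
    unfold HasFiniteIntegral
    have hme : AEMeasurable (fun p : X × U => β ((p.2 : G) • p.1) * ‖Ψ p.1‖ₑ)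
        (ν.prod (μU.restrict 𝓕)) := (hm₁.mul (hΨe.comp measurable_fst)).aemeasurable
    calc ∫⁻ p, ‖uncurry (fun (x : X) (u : U) => wt β ((u : G) • x) • Ψ x) p‖ₑ ∂(ν.prod (μU.restrict 𝓕))
        = ∫⁻ p, β ((p.2 : G) • p.1) * ‖Ψ p.1‖ₑ ∂(ν.prod (μU.restrict 𝓕)) := by
          refine lintegral_congr fun p => ?_
          change ‖wt β ((p.2 : G) • p.1) • Ψ p.1‖ₑ = _
          rw [enorm_smul, enorm_wt_eq (hβlt _).ne]
      _ = ∫⁻ x, ∫⁻ u in 𝓕, β ((u : G) • x) * ‖Ψ x‖ₑ ∂μU ∂ν := lintegral_prod _ hme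
      _ = ∫⁻ x, (∫⁻ u in 𝓕, β ((u : G) • x) ∂μU) * ‖Ψ x‖ₑ ∂ν := by
          refine lintegral_congr fun x => ?_
          rw [lintegral_mul_const _ (hmu x)]
      _ < ∞ := hI
  -- (5) integrability on `𝓕 × X`
  have hint₂ : Integrable (uncurry fun (u : U) (y : X) => wt β y • Ψ ((u : G)⁻¹ • y))
      ((μU.restrict 𝓕).prod ν) := by
    have hsm : Measurable fun p : U × X => ((p.1 : G))⁻¹ • p.2 :=
      (measurable_subtype_coe.comp measurable_fst).inv.smul measurable_snd
    refine ⟨((hβ.comp measurable_snd).ennreal_toReal.aestronglyMeasurable).smul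
      ((hΨm.comp_measurable hsm).aestronglyMeasurable), ?_⟩
    unfold HasFiniteIntegral
    have hme : AEMeasurable (fun p : U × X => β p.2 * ‖Ψ (((p.1 : G))⁻¹ • p.2)‖ₑ)
        ((μU.restrict 𝓕).prod ν) := ((hβ.comp measurable_snd).mul (hΨe.comp hsm)).aemeasurable
    have hme' : AEMeasurable (uncurry fun (u : U) (x : X) => β ((u : G) • x) * ‖Ψ x‖ₑ)
        ((μU.restrict 𝓕).prod ν) := (hm₂.mul (hΨe.comp measurable_snd)).aemeasurable
    calc ∫⁻ p, ‖uncurry (fun (u : U) (y : X) => wt β y • Ψ ((u : G)⁻¹ • y)) p‖ₑ ∂((μU.restrict 𝓕).prod ν)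
        = ∫⁻ p, β p.2 * ‖Ψ (((p.1 : G))⁻¹ • p.2)‖ₑ ∂((μU.restrict 𝓕).prod ν) := by
          refine lintegral_congr fun p => ?_
          change ‖wt β p.2 • Ψ (((p.1 : G))⁻¹ • p.2)‖ₑ = _
          rw [enorm_smul, enorm_wt_eq (hβlt _).ne]
      _ = ∫⁻ u in 𝓕, ∫⁻ y, β y * ‖Ψ ((u : G)⁻¹ • y)‖ₑ ∂ν ∂μU := lintegral_prod _ hme
      _ = ∫⁻ u in 𝓕, ∫⁻ x, β ((u : G) • x) * ‖Ψ x‖ₑ ∂ν ∂μU := by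
          refine lintegral_congr fun u => ?_
          have := (measurePreserving_smul (u : G) ν).lintegral_comp_emb
            (measurableEmbedding_const_smul (u : G)) (fun y => β y * ‖Ψ ((u : G)⁻¹ • y)‖ₑ)
          simp only [inv_smul_smul] at this
          exact this.symm
      _ = ∫⁻ x, ∫⁻ u in 𝓕, β ((u : G) • x) * ‖Ψ x‖ₑ ∂μU ∂ν := lintegral_lintegral_swap hme'
      _ = ∫⁻ x, (∫⁻ u in 𝓕, β ((u : G) • x) ∂μU) * ‖Ψ x‖ₑ ∂ν := by
          refine lintegral_congr fun x => ?_
          rw [lintegral_mul_const _ (hmu x)]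
      _ < ∞ := hI
  -- assembly
  calc ∫ x, wt (avgWeight U μU 𝓕 β) x • Ψ x ∂ν
      = ∫ x, c.toReal⁻¹ • ((∫ u in 𝓕, wt β ((u : G) • x) ∂μU) • Ψ x) ∂ν :=
        integral_congr_ae (ae_of_all _ fun x => by simp only; rw [h1 x, mul_smul])
    _ = c.toReal⁻¹ • ∫ x, (∫ u in 𝓕, wt β ((u : G) • x) ∂μU) • Ψ x ∂ν := integral_smul _ _
    _ = c.toReal⁻¹ • ∫ x, ∫ u in 𝓕, wt β ((u : G) • x) • Ψ x ∂μU ∂ν := by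
        congr 1
        exact integral_congr_ae (ae_of_all _ fun x => (integral_smul_const _ _).symm)
    _ = c.toReal⁻¹ • ∫ u in 𝓕, ∫ x, wt β ((u : G) • x) • Ψ x ∂ν ∂μU := by
        rw [integral_integral_swap hint₁]
    _ = c.toReal⁻¹ • ∫ u in 𝓕, ∫ y, wt β y • Ψ ((u : G)⁻¹ • y) ∂ν ∂μU := by
        congr 1
        exact integral_congr_ae (ae_of_all _ fun u => h4 u)
    _ = c.toReal⁻¹ • ∫ y, ∫ u in 𝓕, wt β y • Ψ ((u : G)⁻¹ • y) ∂μU ∂ν := by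
        rw [integral_integral_swap hint₂]
    _ = ∫ y, c.toReal⁻¹ • ∫ u in 𝓕, wt β y • Ψ ((u : G)⁻¹ • y) ∂μU ∂ν := (integral_smul _ _).symm
    _ = ∫ y, wt β y • ((μU 𝓕).toReal⁻¹ • ∫ u in 𝓕, Ψ ((u : G)⁻¹ • y) ∂μU) ∂ν :=
        integral_congr_ae (ae_of_all _ fun y => by simp only; rw [integral_smul, smul_comm])

end AveragingIdentity

end Literature.MeasureTheory.Group
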